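import Summits.QuantumFields.GaugeBoot.BootstrapRowPencil
import HarnessLib

/-!
# The level-`n` SDP value is a CONTINUOUS function of the coupling off a finite exceptional set (gauge-boot, L1/L4 supplement)

HONEST FRAMING (cell `pub-gaugeboot`, page 1 of every file): the venture produces certified bounds
on lattice expectations at stated coupling, gauge group, dimension and torus size; NOT a mass gap,
NOT a continuum limit, NOT a string tension; NOT Yang–Mills-summit-bearing (barriers
`FixedCouplingUltralocality`, `PerturbativeInvisibility`). Structural; the exceptional set is not
computed and no number is certified.

## Content

`BootstrapCertificateTransport`: the level-`n` SDP upper (lower) bound of an objective `P` is upper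
(lower) semicontinuous in `β`. `BootstrapCouplingJump`: at `β = 0` it can jump. This file proves the
positive statement in between:

* ★ `wilson_integral_ge_exp_mul` — Gibbs comparability: for a pointwise non-negative observable
  `x`, `e^{-2|β-β₀|‖S‖} ∫ x dμ_{β₀} ≤ ∫ x dμ_β` on every torus, for every compact gauge group and
  continuous unitary representation (the Wilson states at nearby couplings are mutually absolutely
  continuous with densities `e^{∓|β-β₀| osc S}`; Mathlib `Measure.tilted`);
* ★★★ `lowerSemicontinuousAt_sSup_levelValues_of_finrank_suN`,
  `continuousAt_sSup_levelValues_of_finrank_suN` (and `sInf` twins) — `SU(N)` on the torus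
  `(ℤ/L)^d`, level `n ≥ 4`, `P` a combination of words of length `≤ 2n`: at every coupling `β₀`
  where the dimension of the level-`n` row space (the span of the loop-equation rows
  `f' - β f S'`) is maximal, the level-`n` SDP upper and lower bounds of `P` are CONTINUOUS in `β`;
* ★★★ `finite_exceptionalCouplings_suN`, `continuousAt_sSup_levelValues_suN` —
  the set of couplings where that dimension is not maximal is FINITE and does not depend on `P`:
  the level-`n` SDP bounds of every such `P` are continuous functions of `β` outside one finite
  set `F_{N,d,L,n} ⊂ ℝ` (by `BootstrapCouplingJump`, `0 ∈ F` as soon as some pinned objective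
  `f ∂S ∉ V_n` exists; at points of `F` only semicontinuity is claimed).

Mechanism: `ConicStability.inner_semicontinuous` with the Wilson states as the comparable Slater
family (faithful: every linear functional is dominated by `W_{β₀}` on the SOS cone,
`exists_abs_apply_mul_self_le`), and `RowPencil.exists_regulariser` for the rows.

References: J. F. Bonnans, A. Shapiro, Perturbation Analysis of Optimization Problems (Springer
2000) Ch. 4; V. Kazakov, Z. Zheng, arXiv:2203.11360 (bounds plotted as functions of the coupling).
Folklore.
-/

noncomputable section

open MeasureTheory Filter Topology NormedSpace
open Literature.MathematicalPhysics.QuantumFieldTheory (LatticeRep Edge GaugeConfig wilsonAction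
  wilsonMeasure isProbabilityMeasure_wilsonMeasure haarProbability)
open Literature.MathematicalPhysics.QuantumLattice

namespace Summit.QuantumFields.GaugeBoot

/-! ## Gibbs comparability of the Wilson states at nearby couplings -/

section Torus

variable {d L : ℕ} [NeZero L] {G : Type*} [Group G] [TopologicalSpace G] [IsTopologicalGroup G]
  [CompactSpace G] [MeasurableSpace G] [BorelSpace G] [SecondCountableTopology G] (r : LatticeRep G)

/-- ★ **Gibbs comparability of the Wilson states**: for a pointwise non-negative continuous
observable `x` and couplings `β, β₀`,
`e^{-2|β-β₀| ‖S‖} ∫ x dμ_{β₀} ≤ ∫ x dμ_β` (`‖S‖` the sup norm of the Wilson action): `μ_β` is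
`μ_{β₀}` tilted by `e^{-(β-β₀)S}`, a density between `e^{-2|β-β₀|‖S‖}` and `e^{2|β-β₀|‖S‖}`.
[folklore] -/
theorem wilson_integral_ge_exp_mul (β β₀ : ℝ) {x : C(GaugeConfig d L G, ℝ)} (hx : ∀ U, 0 ≤ x U) :
    Real.exp (-(2 * (|β - β₀| * ‖wilsonActionCM (d := d) (L := L) r‖))) *
        ∫ U, x U ∂(wilsonMeasure (d := d) (L := L) r.ρ β₀) ≤
      ∫ U, x U ∂(wilsonMeasure (d := d) (L := L) r.ρ β) := by
  set π : Measure (GaugeConfig d L G) := Measure.pi fun _ : Edge d L => haarProbability G with hπ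
  haveI : IsProbabilityMeasure π := by rw [hπ]; infer_instance
  haveI hP₀ : IsProbabilityMeasure (wilsonMeasure (d := d) (L := L) r.ρ β₀) :=
    isProbabilityMeasure_wilsonMeasure (ρ := r.ρ) r.continuous β₀
  set S := wilsonActionCM (d := d) (L := L) r with hS
  set h : ℝ := |β - β₀| * ‖S‖ with hh
  set g : GaugeConfig d L G → ℝ := fun U => -(β - β₀) * S U with hg
  have hgc : Continuous g := continuous_const.mul S.continuous
  have hgb : ∀ U, |g U| ≤ h := fun U => by
    rw [hg, abs_mul, abs_neg, hh]
    exact mul_le_mul_of_nonneg_left ((Real.norm_eq_abs _).symm.le.trans (S.norm_coe_le_norm U))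
      (abs_nonneg _)
  -- `μ_β = μ_{β₀}` tilted by `g`
  have hint : Integrable (fun U : GaugeConfig d L G => Real.exp (-β₀ * wilsonAction r.ρ U)) π :=
    integrable_of_continuous_compact (Real.continuous_exp.comp (continuous_const.mul S.continuous)) π
  have htilt : wilsonMeasure (d := d) (L := L) r.ρ β = (wilsonMeasure (d := d) (L := L) r.ρ β₀).tilted g := by
    rw [wilsonMeasure_eq_tilted_pi r.ρ r.continuous β, wilsonMeasure_eq_tilted_pi r.ρ r.continuous β₀,
      tilted_tilted hint]
    congr 1
    funext U
    simp only [Pi.add_apply, hg, hS, coe_wilsonActionCM]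
    ring
  -- the normalisation and the density bounds
  set Z : ℝ := ∫ U, Real.exp (g U) ∂(wilsonMeasure (d := d) (L := L) r.ρ β₀) with hZ
  have hexp_int : Integrable (fun U => Real.exp (g U)) (wilsonMeasure (d := d) (L := L) r.ρ β₀) :=
    integrable_of_continuous_compact (Real.continuous_exp.comp hgc) _
  have hZle : Z ≤ Real.exp h := by
    have h1 : Z ≤ ∫ _, Real.exp h ∂(wilsonMeasure (d := d) (L := L) r.ρ β₀) :=
      integral_mono hexp_int (integrable_const _) fun U =>
        Real.exp_le_exp.2 ((le_abs_self _).trans (hgb U))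
    simpa using h1
  have hZge : Real.exp (-h) ≤ Z := by
    have h1 : ∫ _, Real.exp (-h) ∂(wilsonMeasure (d := d) (L := L) r.ρ β₀) ≤ Z :=
      integral_mono (integrable_const _) hexp_int fun U =>
        Real.exp_le_exp.2 ((neg_le.1 ((neg_le_abs _).trans (hgb U))))
    simpa using h1
  have hZpos : 0 < Z := lt_of_lt_of_le (Real.exp_pos _) hZge
  have hdens : ∀ U, Real.exp (-(2 * h)) ≤ Real.exp (g U) / Z := by
    intro U
    rw [le_div_iff₀ hZpos]
    have h1 : Real.exp (-h) ≤ Real.exp (g U) :=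
      Real.exp_le_exp.2 (neg_le.1 ((neg_le_abs _).trans (hgb U)))
    calc Real.exp (-(2 * h)) * Z ≤ Real.exp (-(2 * h)) * Real.exp h :=
          mul_le_mul_of_nonneg_left hZle (Real.exp_pos _).le
      _ = Real.exp (-h) := by rw [← Real.exp_add]; ring_nf
      _ ≤ Real.exp (g U) := h1
  -- compare the integrals
  rw [htilt, integral_tilted]
  have hcont : Continuous fun U => (Real.exp (g U) / Z) • x U :=
    ((Real.continuous_exp.comp hgc).div_const Z).smul x.continuous
  calc Real.exp (-(2 * h)) * ∫ U, x U ∂(wilsonMeasure (d := d) (L := L) r.ρ β₀)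
        = ∫ U, Real.exp (-(2 * h)) * x U ∂(wilsonMeasure (d := d) (L := L) r.ρ β₀) :=
          (integral_const_mul _ _).symm
    _ ≤ ∫ U, (Real.exp (g U) / Z) • x U ∂(wilsonMeasure (d := d) (L := L) r.ρ β₀) :=
          integral_mono ((integrable_of_continuous_compact x.continuous _).const_mul _)
            (integrable_of_continuous_compact hcont _) fun U => by
              simpa only [smul_eq_mul] using mul_le_mul_of_nonneg_right (hdens U) (hx U)

end Torus

/-! ## `SU(N)` on the torus: continuity at couplings of maximal row rank -/

section SuN

variable {d L : ℕ} [NeZero L] (N : ℕ)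

/-- **The exceptional couplings** of the level-`n` `SU(N)` torus bootstrap: those `β` at which the
dimension of the level-`n` row space is not maximal. [folklore] -/
def exceptionalCouplings (n : ℕ) : Set ℝ :=
  {β | Module.finrank ℝ (rowSpace (fundamentalLatticeRep N) (suExp N)
      (fun _ : Edge d L => wilsonAction (fundamentalRep (Fin N))) β
      (wordTruncation (ι := Edge d L) (fundamentalLatticeRep N) n)) ≠
    RowPencil.maxRank (LinearMap.fst ℝ _ _ ∘ₗ (pairSpanSuN (d := d) (L := L) N n).subtype)
      (LinearMap.snd ℝ _ _ ∘ₗ (pairSpanSuN (d := d) (L := L) N n).subtype)}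

/-- The dimension of the level-`n` row space is the dimension of the pencil range. -/
theorem finrank_rowSpaceSuN_eq (n : ℕ) (β : ℝ) :
    Module.finrank ℝ (rowSpace (fundamentalLatticeRep N) (suExp N)
      (fun _ : Edge d L => wilsonAction (fundamentalRep (Fin N))) β
      (wordTruncation (ι := Edge d L) (fundamentalLatticeRep N) n)) =
    Module.finrank ℝ (RowPencil.pencilRange
      (LinearMap.fst ℝ _ _ ∘ₗ (pairSpanSuN (d := d) (L := L) N n).subtype)
      (LinearMap.snd ℝ _ _ ∘ₗ (pairSpanSuN (d := d) (L := L) N n).subtype) β) :=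
  (LinearEquiv.ofEq _ _ (rowSpaceSuN_eq_pencilRange N n β)).finrank_eq

/-- ★★ **The exceptional couplings form a FINITE set** (independent of the objective). -/
theorem finite_exceptionalCouplings_suN (n : ℕ) :
    (exceptionalCouplings (d := d) (L := L) N n).Finite := by
  refine (RowPencil.finite_setOf_finrank_ne_maxRank
    (L₀ := LinearMap.fst ℝ _ _ ∘ₗ (pairSpanSuN (d := d) (L := L) N n).subtype)
    (L₁ := LinearMap.snd ℝ _ _ ∘ₗ (pairSpanSuN (d := d) (L := L) N n).subtype)).subset fun β hβ => ?_
  simp only [exceptionalCouplings, Set.mem_setOf_eq, finrank_rowSpaceSuN_eq] at hβ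
  exact hβ

/-- ★★★ **Inner semicontinuity of the level-`n` feasible sets at a non-exceptional coupling.**
`SU(N)`, torus, any level `n`, any objective `P`, `β₀ ∉ exceptionalCouplings`: every level-`n`
feasible value of `P` at `β₀` is approximated by level-`n` feasible values at all nearby `β`.
[folklore] -/
theorem levelValues_inner_semicontinuous_suN {n : ℕ} {β₀ : ℝ}
    (hβ₀ : β₀ ∉ exceptionalCouplings (d := d) (L := L) N n)
    (P : C(GaugeConfig d L (Matrix.specialUnitaryGroup (Fin N) ℂ), ℝ))
    {t₀ : ℝ} (ht₀ : t₀ ∈ levelValuesSuN (d := d) (L := L) N β₀ n P) {ε : ℝ} (hε : 0 < ε) :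
    ∀ᶠ β in 𝓝 β₀, ∃ t ∈ levelValuesSuN (d := d) (L := L) N β n P, |t - t₀| < ε := by
  classical
  -- notation
  set V := wordTruncation (ι := Edge d L) (fundamentalLatticeRep N) n with hV
  set R : ℝ → Submodule ℝ C(GaugeConfig d L (Matrix.specialUnitaryGroup (Fin N) ℂ), ℝ) := fun β =>
    rowSpace (fundamentalLatticeRep N) (suExp N) (fun _ : Edge d L => wilsonAction (fundamentalRep (Fin N)))
      β V with hR
  have hRp : ∀ β, R β = RowPencil.pencilRange
      (LinearMap.fst ℝ _ _ ∘ₗ (pairSpanSuN (d := d) (L := L) N n).subtype)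
      (LinearMap.snd ℝ _ _ ∘ₗ (pairSpanSuN (d := d) (L := L) N n).subtype) β := fun β =>
    rowSpaceSuN_eq_pencilRange N n β
  -- the Wilson states: a comparable Slater family
  haveI hprob : ∀ β : ℝ, IsProbabilityMeasure (wilsonMeasure (d := d) (L := L) (fundamentalRep (Fin N)) β) :=
    fun β => isProbabilityMeasure_wilsonMeasure (ρ := fundamentalRep (Fin N)) (continuous_fundamentalRep _) β
  set ψ : ℝ → (C(GaugeConfig d L (Matrix.specialUnitaryGroup (Fin N) ℂ), ℝ) →ₗ[ℝ] ℝ) := fun β =>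
    expectationFunctional (wilsonMeasure (d := d) (L := L) (fundamentalRep (Fin N)) β) with hψ
  have hψF : ∀ β, ψ β ∈ ConicStability.Feasible (sosCone V : Set _) 1 (R β) := fun β =>
    (isBootstrapFeasible_iff_mem_feasible (fundamentalLatticeRep N) (wilsonAction_polyDeriv_suN N)).1
      (isBootstrapFeasible_wilson_suN N β _ rfl (wordTruncation_subset_polyAlgebra _ n))
  set m : ℝ := Real.exp (-(2 * (1 * ‖wilsonActionCM (d := d) (L := L) (fundamentalLatticeRep N)‖))) with hm
  have hm0 : 0 < m := Real.exp_pos _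
  have hψK : ∀ᶠ β in 𝓝 β₀, ∀ x ∈ (sosCone V : Set _), m * ψ β₀ x ≤ ψ β x := by
    filter_upwards [Metric.ball_mem_nhds β₀ one_pos] with β hβ x hx
    rw [Metric.mem_ball, Real.dist_eq] at hβ
    have hx0 : ∀ U, 0 ≤ x U := apply_nonneg_of_mem_sosCone hx
    have h1 := wilson_integral_ge_exp_mul (fundamentalLatticeRep N) β β₀ hx0
    have hI0 : 0 ≤ ∫ U, x U ∂(wilsonMeasure (d := d) (L := L) (fundamentalLatticeRep N).ρ β₀) :=
      integral_nonneg hx0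
    have h2 : m ≤ Real.exp (-(2 * (|β - β₀| * ‖wilsonActionCM (d := d) (L := L) (fundamentalLatticeRep N)‖))) := by
      rw [hm]
      refine Real.exp_le_exp.2 (neg_le_neg (mul_le_mul_of_nonneg_left
        (mul_le_mul_of_nonneg_right hβ.le (norm_nonneg _)) (by norm_num)))
    calc m * ψ β₀ x ≤ Real.exp (-(2 * (|β - β₀| * ‖wilsonActionCM (d := d) (L := L)
          (fundamentalLatticeRep N)‖))) * ψ β₀ x := mul_le_mul_of_nonneg_right h2 hI0
      _ ≤ ψ β x := h1
  have hψP : ∀ᶠ β in 𝓝 β₀, |ψ β P| ≤ ‖P‖ := Eventually.of_forall fun β => by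
    rw [abs_le]
    constructor
    · have h := expectationFunctional_le_norm (wilsonMeasure (d := d) (L := L) (fundamentalRep (Fin N)) β) (-P)
      rw [map_neg, norm_neg, one_mul] at h
      linarith
    · have h := expectationFunctional_le_norm (wilsonMeasure (d := d) (L := L) (fundamentalRep (Fin N)) β) P
      rw [one_mul] at h
      exact h
  -- the regulariser of the rows at a point of maximal rank
  have hβ₀' : Module.finrank ℝ (RowPencil.pencilRange
      (LinearMap.fst ℝ _ _ ∘ₗ (pairSpanSuN (d := d) (L := L) N n).subtype)
      (LinearMap.snd ℝ _ _ ∘ₗ (pairSpanSuN (d := d) (L := L) N n).subtype) β₀) =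
      RowPencil.maxRank (LinearMap.fst ℝ _ _ ∘ₗ (pairSpanSuN (d := d) (L := L) N n).subtype)
        (LinearMap.snd ℝ _ _ ∘ₗ (pairSpanSuN (d := d) (L := L) N n).subtype) := by
    by_contra h
    exact hβ₀ (by simp only [exceptionalCouplings, Set.mem_setOf_eq, finrank_rowSpaceSuN_eq]; exact h)
  obtain ⟨s, π, g, hQ, hg₀, hgc⟩ := RowPencil.exists_regulariser hβ₀'
  simp only [← hRp] at hQ hg₀
  -- domination of the `π i` on the SOS cone by the faithful Wilson state at `β₀`
  set W : Submodule ℝ C(GaugeConfig d L (Matrix.specialUnitaryGroup (Fin N) ℂ), ℝ) :=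
    Submodule.span ℝ (wordsUpTo (ι := Edge d L) (fundamentalLatticeRep N) n) with hW
  haveI : FiniteDimensional ℝ W :=
    FiniteDimensional.span_of_finite ℝ (wordsUpTo_finite (fundamentalLatticeRep N) n)
  have hpos : ∀ v ∈ W, v ≠ 0 → 0 < ψ β₀ (v * v) := by
    intro v _ hv
    refine lt_of_le_of_ne (expectationFunctional_sq_nonneg _ v) fun h => hv ?_
    haveI : IsProbabilityMeasure (wilsonMeasure (d := d) (L := L) (fundamentalLatticeRep N).ρ β₀) := hprob β₀
    exact eq_zero_of_wilson_integral_mul_self_eq_zero (fundamentalLatticeRep N) β₀ v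
      (by rw [← expectationFunctional_apply]; exact h.symm)
  have hdom : ∀ i, ∃ C : ℝ, 0 ≤ C ∧ ∀ x ∈ (sosCone V : Set _), |π i x| ≤ C * ψ β₀ x := by
    intro i
    obtain ⟨C, hC0, hC⟩ := exists_abs_apply_mul_self_le W (ψ β₀) (π i) hpos
    exact ⟨C, hC0, fun x hx => abs_apply_le_of_mem_sosCone (fun v hv => hC v hv) hx⟩
  choose C hC0 hC using hdom
  set D : ℝ := ∑ i, C i with hD
  have hD0 : 0 ≤ D := Finset.sum_nonneg fun i _ => hC0 i
  have hDdom : ∀ i, ∀ x ∈ (sosCone V : Set _), |π i x| ≤ D * ψ β₀ x := by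
    intro i x hx
    have h0 : 0 ≤ ψ β₀ x := (hψF β₀).2.1 x hx
    exact (hC i x hx).trans (mul_le_mul_of_nonneg_right
      (Finset.single_le_sum (fun j _ => hC0 j) (Finset.mem_univ i)) h0)
  -- inner semicontinuity of the conic feasible sets, transported to `levelValues`
  rw [levelValuesSuN_eq_image_feasible] at ht₀
  obtain ⟨φ₀, hφ₀, rfl⟩ := ht₀
  have key := ConicStability.inner_semicontinuous (K := (sosCone V : Set _)) (u := 1) (P := P) (R := R)
    (Eventually.of_forall hψF) hm0 hψK hψP π g hQ hg₀ hgc hD0 hDdom hφ₀ hε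
  filter_upwards [key] with β hβ
  obtain ⟨φ, hφ, hclose⟩ := hβ
  refine ⟨φ P, ?_, hclose⟩
  rw [levelValuesSuN_eq_image_feasible]
  exact ⟨φ, hφ, rfl⟩

/-- ★★★ **Lower semicontinuity of the SDP upper bound at a non-exceptional coupling** (`P` in the
level-`n` certificate domain, so that the feasible values form a compact interval). [folklore] -/
theorem lowerSemicontinuousAt_sSup_levelValues_suN {n : ℕ} {β₀ : ℝ}
    (hβ₀ : β₀ ∉ exceptionalCouplings (d := d) (L := L) N n)
    {P : C(GaugeConfig d L (Matrix.specialUnitaryGroup (Fin N) ℂ), ℝ)}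
    (hP : ∀ β : ℝ, P ∈ certDomainSuN (d := d) (L := L) N β n) :
    LowerSemicontinuousAt (fun β : ℝ => sSup (levelValuesSuN (d := d) (L := L) N β n P)) β₀ := by
  intro y hy
  dsimp only at hy
  obtain ⟨lo, hi, hIcc, hW⟩ := levelValues_eq_Icc_suN N β₀ (hP β₀)
  have hlohi : lo ≤ hi := hW.1.trans hW.2
  rw [hIcc, csSup_Icc hlohi] at hy
  have hhi : hi ∈ levelValuesSuN (d := d) (L := L) N β₀ n P := by
    rw [hIcc]; exact Set.right_mem_Icc.2 hlohi
  filter_upwards [levelValues_inner_semicontinuous_suN N hβ₀ P hhi (sub_pos.2 hy)] with β hβ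
  obtain ⟨t, ht, hclose⟩ := hβ
  obtain ⟨lo', hi', hIcc', hW'⟩ := levelValues_eq_Icc_suN N β (hP β)
  have hlohi' : lo' ≤ hi' := hW'.1.trans hW'.2
  show y < sSup (levelValuesSuN (d := d) (L := L) N β n P)
  rw [hIcc', csSup_Icc hlohi']
  rw [hIcc'] at ht
  have h1 := (abs_lt.1 hclose).1
  linarith [ht.2]

/-- ★★★ **Upper semicontinuity of the SDP lower bound at a non-exceptional coupling.** [folklore] -/
theorem upperSemicontinuousAt_sInf_levelValues_suN {n : ℕ} {β₀ : ℝ}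
    (hβ₀ : β₀ ∉ exceptionalCouplings (d := d) (L := L) N n)
    {P : C(GaugeConfig d L (Matrix.specialUnitaryGroup (Fin N) ℂ), ℝ)}
    (hP : ∀ β : ℝ, P ∈ certDomainSuN (d := d) (L := L) N β n) :
    UpperSemicontinuousAt (fun β : ℝ => sInf (levelValuesSuN (d := d) (L := L) N β n P)) β₀ := by
  intro y hy
  dsimp only at hy
  obtain ⟨lo, hi, hIcc, hW⟩ := levelValues_eq_Icc_suN N β₀ (hP β₀)
  have hlohi : lo ≤ hi := hW.1.trans hW.2
  rw [hIcc, csInf_Icc hlohi] at hy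
  have hlo : lo ∈ levelValuesSuN (d := d) (L := L) N β₀ n P := by
    rw [hIcc]; exact Set.left_mem_Icc.2 hlohi
  filter_upwards [levelValues_inner_semicontinuous_suN N hβ₀ P hlo (sub_pos.2 hy)] with β hβ
  obtain ⟨t, ht, hclose⟩ := hβ
  obtain ⟨lo', hi', hIcc', hW'⟩ := levelValues_eq_Icc_suN N β (hP β)
  have hlohi' : lo' ≤ hi' := hW'.1.trans hW'.2
  show sInf (levelValuesSuN (d := d) (L := L) N β n P) < y
  rw [hIcc', csInf_Icc hlohi']
  rw [hIcc'] at ht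
  have h1 := (abs_lt.1 hclose).2
  linarith [ht.1]

/-- ★★★ **Continuity of the level-`n` SDP bounds at every non-exceptional coupling** (`n ≥ 4`,
`P` in every level-`n` certificate domain — e.g. a combination of words of length `≤ 2n`).
[folklore] -/
theorem continuousAt_levelValues_bounds_suN {n : ℕ} (hn : 4 ≤ n) {β₀ : ℝ}
    (hβ₀ : β₀ ∉ exceptionalCouplings (d := d) (L := L) N n)
    {P : C(GaugeConfig d L (Matrix.specialUnitaryGroup (Fin N) ℂ), ℝ)}
    (hP : ∀ β : ℝ, P ∈ certDomainSuN (d := d) (L := L) N β n) :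
    ContinuousAt (fun β : ℝ => sSup (levelValuesSuN (d := d) (L := L) N β n P)) β₀ ∧
      ContinuousAt (fun β : ℝ => sInf (levelValuesSuN (d := d) (L := L) N β n P)) β₀ :=
  ⟨continuousAt_iff_lower_upperSemicontinuousAt.2
      ⟨lowerSemicontinuousAt_sSup_levelValues_suN N hβ₀ hP,
        (upperSemicontinuous_sSup_levelValues_suN N hn hP) β₀⟩,
    continuousAt_iff_lower_upperSemicontinuousAt.2
      ⟨(lowerSemicontinuous_sInf_levelValues_suN N hn hP) β₀,
        upperSemicontinuousAt_sInf_levelValues_suN N hβ₀ hP⟩⟩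

/-- ★★★ **The level-`n` SDP bounds are continuous in the coupling off ONE finite set.** `SU(N)` on
the torus `(ℤ/L)^d`, level `n ≥ 4`: there is a finite set `F ⊂ ℝ` (the exceptional couplings of
the level-`n` row space; independent of the objective) such that for every objective `P` which is
a combination of words of length `≤ 2n`, the level-`n` SDP upper bound `β ↦ sup` and lower bound
`β ↦ inf` of `P` are continuous at every `β ∉ F`. [folklore] -/
theorem continuousAt_sSup_levelValues_suN {n : ℕ} (hn : 4 ≤ n) :
    ∃ F : Set ℝ, F.Finite ∧
      ∀ P : C(GaugeConfig d L (Matrix.specialUnitaryGroup (Fin N) ℂ), ℝ),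
        P ∈ wordTruncation (ι := Edge d L) (fundamentalLatticeRep N) (n + n) →
        ∀ β₀ ∉ F,
          ContinuousAt (fun β : ℝ => sSup (levelValuesSuN (d := d) (L := L) N β n P)) β₀ ∧
            ContinuousAt (fun β : ℝ => sInf (levelValuesSuN (d := d) (L := L) N β n P)) β₀ :=
  ⟨exceptionalCouplings (d := d) (L := L) N n, finite_exceptionalCouplings_suN N n,
    fun _ hP _ hβ₀ => continuousAt_levelValues_bounds_suN N hn hβ₀
      fun β => mem_certDomainSuN_of_mem_wordTruncation N β le_rfl hP⟩

end SuN

end Summit.QuantumFields.GaugeBoot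

end
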